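import Literature.NumberTheory.Sieve.MontgomeryVaughan1975GaussSums
import Mathlib.Analysis.SpecialFunctions.Pow.Complex
import HarnessLib

/-!
# The `n`-normalised Kato Euler factors: Gauss-sum bookkeeping for PK-4b-C4b-2
# (cell `b2b-bsdres`, team n1011, ROUTE-1 PORT anatomy (P-KIM); R1-71/R1-72: PK-4b
# `KatoZetaValueDerivativeCongruence`, layer PK-4b-C4b-2a; seat p15 GEN 9)

HONEST FRAMING (cell `b2b-bsdres`, run/shared/lean/b2b/bsd-rank1-residual/, verbatim in every
file): the goal of the cell is to DELETE the COMBINATION-SHAPED residual classes of the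
Birch–Swinnerton-Dyer formula for ALL analytic-rank `≤ 1` elliptic curves over `ℚ` — "full BSD
formula for every rank `≤ 1` curve in class `C`" assembled STRICTLY from published theorems — so
that the rank-`≤ 1` remainder becomes exactly the CONSTRUCTION-SHAPED classes, which are TYPED
(missing-input `Prop`s), NOT attempted. This is not "finishing BSD". Team n1011 (N10/N11; ROUTE 1,
the PORT anatomy (P-KIM) of class X4 ∧ `p = 3`): research route on CONSTRUCTION-SHAPED classes;
prove what is provable now; no claim beyond stated classes; census output = EVIDENCE, never a
Literature fact; RESIDUAL-MAP marks UNCHANGED; nothing is booked by this file. TOOL THEOREMS ONLY: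
no definition, no named fact, no instance, no `sorry`.

## What

The three scalar identities that turn PK-4a's character sums (p02 `ZetaValueCharSum.charSum_eq_of_even`,
Kato's `S`-depleted Euler factors `E_ℓ(χ₀) = 1 − χ₀(ℓ)a_ℓℓ⁻¹ + ℓ·χ₀(ℓ)²ℓ⁻²` and the Birch quotient by
`τ(χ₀⁻¹)`) into the components of the `n`-NORMALISED Kato avatar used by PK-4b-C3/C4 (r1 GEN 45, binder
sheet 56.3 (E)): for `χ₀` primitive mod `n₀ ∣ n`, `n` square-free,
* `neg_mul_mul_eulerFactor_eq`: `−ℓ·χ₀⁻¹(ℓ)·E_ℓ(χ₀) = a_ℓ − χ₀(ℓ) − ℓ·χ₀⁻¹(ℓ)` (`ℓ ∤ N`) — the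
  `n`-normalised Kato factor, to be compared with the Mazur–Tate factor `a_ℓ − χ₀(ℓ) − χ₀⁻¹(ℓ)`: the
  difference is `(1 − ℓ)·χ₀⁻¹(ℓ)`;
* `div_gaussSum_mul_gaussSum_changeLevel_eq`:
  `n / (τ(χ₀⁻¹) · τ_n(χ₀↑)) = χ₀(−1) · (n/n₀) · μ(n/n₀) · χ₀⁻¹(n/n₀)` (Montgomery–Vaughan 1975 L.5.2
  `gaussSum_changeLevel` + `τ(χ₀)τ(χ₀⁻¹) = χ₀(−1)n₀`);
* `moebius_prod_primes` / `prod_neg_mul_eq`: over the primes `ℓ_i` (`i ∈ T`) of `n/n₀`,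
  `(∏ ℓ_i) · μ(∏ ℓ_i) · χ₀⁻¹(∏ ℓ_i) · ∏ E_i = ∏ (−ℓ_i χ₀⁻¹(ℓ_i) E_i)`.
HONEST LIMITS: scalar algebra only; no Kato object, no group ring; closes nothing.

References: H. L. Montgomery, R. C. Vaughan, Acta Arith. 27 (1975) Lemma 5.2; K. Kato, Astérisque 295
(2004) Thm. 6.6; r1 ROUTE-1 §57 (cells/n1011/ROUTE-1.md).
-/

noncomputable section

namespace Summit.BirchSwinnertonDyer.Rank1Residual.GaloisImage

namespace EulerFactorComparison

open Finset
open scoped BigOperators ArithmeticFunction.Moebius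

/-! ### §1 The per-prime identity -/

/-- **The `n`-normalised Kato Euler factor at an imprimitive prime**: for `ℓ ∤ N` and
`χ₀(ℓ)χ₀⁻¹(ℓ) = 1`,
`−ℓ χ₀⁻¹(ℓ) (1 − χ₀(ℓ) a ℓ⁻¹ + ℓ χ₀(ℓ)² ℓ⁻²) = a − χ₀(ℓ) − ℓ χ₀⁻¹(ℓ)` (PK-4a's token shape, with
`ℓ^{-1}` as a complex power). [folklore] -/
theorem neg_mul_mul_eulerFactor_eq {N ℓ n₀ : ℕ} (hℓN : ¬ ℓ ∣ N) (hℓ0 : (ℓ : ℂ) ≠ 0)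
    (χ₀ : DirichletCharacter ℂ n₀) (a : ℂ) (hunit : χ₀ (ℓ : ZMod n₀) * χ₀⁻¹ (ℓ : ZMod n₀) = 1) :
    -(ℓ : ℂ) * χ₀⁻¹ (ℓ : ZMod n₀) *
        (1 - χ₀ (ℓ : ZMod n₀) * a * (ℓ : ℂ) ^ (-(1 : ℂ)) +
          (if ℓ ∣ N then 0 else (ℓ : ℂ)) * χ₀ (ℓ : ZMod n₀) ^ 2 * ((ℓ : ℂ) ^ (-(1 : ℂ))) ^ 2) =
      a - χ₀ (ℓ : ZMod n₀) - (ℓ : ℂ) * χ₀⁻¹ (ℓ : ZMod n₀) := by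
  rw [if_neg hℓN, Complex.cpow_neg_one]
  have hinv : (ℓ : ℂ) * (ℓ : ℂ)⁻¹ = 1 := mul_inv_cancel₀ hℓ0
  linear_combination (a - χ₀ (ℓ : ZMod n₀)) * hunit +
    (a * (χ₀ (ℓ : ZMod n₀) * χ₀⁻¹ (ℓ : ZMod n₀)) -
      χ₀ (ℓ : ZMod n₀) * (χ₀ (ℓ : ZMod n₀) * χ₀⁻¹ (ℓ : ZMod n₀)) * ((ℓ : ℂ) * (ℓ : ℂ)⁻¹ + 1)) * hinv

/-- The unit relation `χ₀(m) χ₀⁻¹(m) = 1` for `m` coprime to the modulus. [folklore] -/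
theorem apply_mul_inv_apply_eq_one {n₀ : ℕ} (χ₀ : DirichletCharacter ℂ n₀) {m : ℕ} (hm : m.Coprime n₀) :
    χ₀ (m : ZMod n₀) * χ₀⁻¹ (m : ZMod n₀) = 1 := by
  rw [← MulChar.mul_apply, mul_inv_cancel, MulChar.one_apply]
  exact (ZMod.isUnit_iff_coprime m n₀).mpr hm

/-! ### §2 The Gauss-sum normalisation -/

/-- **`n / (τ(χ₀⁻¹) τ_n(χ₀↑)) = χ₀(−1) (n/n₀) μ(n/n₀) χ₀⁻¹(n/n₀)`** for `χ₀` primitive mod `n₀ ∣ n` with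
`μ(n/n₀) ≠ 0` and `(n/n₀, n₀) = 1` (both automatic for square-free `n`).
[cite: MontgomeryVaughanActa1975, §5 Lemma 5.2] -/
theorem div_gaussSum_mul_gaussSum_changeLevel_eq {n n₀ : ℕ} [NeZero n] [NeZero n₀] (hn₀ : n₀ ∣ n)
    {χ₀ : DirichletCharacter ℂ n₀} (hχ₀ : χ₀.IsPrimitive) (hμ : (μ (n / n₀) : ℂ) ≠ 0)
    (hcop : (n / n₀).Coprime n₀) :
    (n : ℂ) / (gaussSum χ₀⁻¹ (ZMod.stdAddChar (N := n₀)) *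
        gaussSum (DirichletCharacter.changeLevel hn₀ χ₀) (ZMod.stdAddChar (N := n))) =
      χ₀ (-1) * ((n / n₀ : ℕ) : ℂ) * (μ (n / n₀) : ℂ) * χ₀⁻¹ ((n / n₀ : ℕ) : ZMod n₀) := by
  rw [Literature.NumberTheory.Sieve.MontgomeryVaughan1975.gaussSum_changeLevel hn₀ χ₀]
  have hgg := Literature.NumberTheory.Sieve.LargeSieve.gaussSum_mul_gaussSum_inv hχ₀
  -- `τ(χ₀⁻¹) · (μ χ₀(m) τ(χ₀)) = μ χ₀(m) χ₀(-1) n₀`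
  have hden : gaussSum χ₀⁻¹ (ZMod.stdAddChar (N := n₀)) *
      ((μ (n / n₀) : ℂ) * χ₀ ((n / n₀ : ℕ) : ZMod n₀) * gaussSum χ₀ (ZMod.stdAddChar (N := n₀))) =
      (μ (n / n₀) : ℂ) * χ₀ ((n / n₀ : ℕ) : ZMod n₀) * (χ₀ (-1) * n₀) := by
    rw [← hgg]; ring
  rw [hden]
  have hn : (n : ℂ) = ((n / n₀ : ℕ) : ℂ) * (n₀ : ℂ) := by
    rw [← Nat.cast_mul, Nat.div_mul_cancel hn₀]
  have hn₀0 : (n₀ : ℂ) ≠ 0 := by exact_mod_cast NeZero.ne n₀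
  have hunit := apply_mul_inv_apply_eq_one χ₀ hcop
  -- `μ² = 1`, `χ₀(-1)² = 1`
  have hμsq : (μ (n / n₀) : ℂ) * (μ (n / n₀) : ℂ) = 1 := by
    have h := ArithmeticFunction.moebius_ne_zero_iff_eq_or.mp (by exact_mod_cast hμ : μ (n / n₀) ≠ 0)
    rcases h with h | h <;> simp [h]
  have hm1 : χ₀ (-1) * χ₀ (-1) = 1 := by
    rw [← map_mul, neg_mul_neg, one_mul, map_one]
  have hχm : χ₀ ((n / n₀ : ℕ) : ZMod n₀) ≠ 0 := fun h => by rw [h, zero_mul] at hunit; exact zero_ne_one hunit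
  have hχ1 : χ₀ (-1) ≠ 0 := fun h => by rw [h, zero_mul] at hm1; exact zero_ne_one hm1
  rw [hn, div_eq_iff (mul_ne_zero (mul_ne_zero hμ hχm) (mul_ne_zero hχ1 hn₀0))]
  linear_combination (-(((n / n₀ : ℕ) : ℂ) * (n₀ : ℂ))) *
    (χ₀ (-1) * χ₀ (-1) * ((μ (n / n₀) : ℂ) * (μ (n / n₀) : ℂ)) * hunit + χ₀ (-1) * χ₀ (-1) * hμsq + hm1)

/-! ### §3 Over the primes of `n/n₀` -/

/-- `μ(∏_{i∈T} ℓ_i) = (−1)^{#T}` for distinct primes. [folklore] -/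
theorem moebius_prod_primes {ι : Type*} (ℓ : ι → ℕ) [hℓ : ∀ i, Fact (ℓ i).Prime]
    (hinj : Function.Injective ℓ) (T : Finset ι) : μ (∏ i ∈ T, ℓ i) = (-1) ^ T.card := by
  classical
  induction T using Finset.induction_on with
  | empty => simp
  | insert j T hj ih =>
    rw [Finset.prod_insert hj, Finset.card_insert_of_notMem hj, pow_succ,
      ArithmeticFunction.isMultiplicative_moebius.map_mul_of_coprime, ih,
      ArithmeticFunction.moebius_apply_prime (hℓ j).out]
    · ring
    · exact Nat.Coprime.prod_right fun i hi =>
        (Nat.coprime_primes (hℓ j).out (hℓ i).out).mpr fun e => hj (hinj e ▸ hi)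

/-- **Product form of the normalisation**: with `m = ∏_{i∈T} ℓ_i` (distinct primes),
`m · μ(m) · χ₀⁻¹(m) · ∏_{i∈T} E_i = ∏_{i∈T} (−ℓ_i · χ₀⁻¹(ℓ_i) · E_i)` for any factors `E_i`. [folklore] -/
theorem prod_mul_moebius_mul_inv_apply_mul_prod_eq {ι : Type*} (ℓ : ι → ℕ) [hℓ : ∀ i, Fact (ℓ i).Prime]
    (hinj : Function.Injective ℓ) (T : Finset ι) {n₀ : ℕ} (χ₀ : DirichletCharacter ℂ n₀) (E : ι → ℂ) :
    ((∏ i ∈ T, ℓ i : ℕ) : ℂ) * (μ (∏ i ∈ T, ℓ i) : ℂ) * χ₀⁻¹ ((∏ i ∈ T, ℓ i : ℕ) : ZMod n₀) *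
        ∏ i ∈ T, E i =
      ∏ i ∈ T, (-(ℓ i : ℂ) * χ₀⁻¹ (ℓ i : ZMod n₀) * E i) := by
  classical
  rw [moebius_prod_primes ℓ hinj T, Nat.cast_prod, Nat.cast_prod, map_prod, Int.cast_pow, Int.cast_neg,
    Int.cast_one, Finset.prod_mul_distrib, Finset.prod_mul_distrib]
  have : ∏ i ∈ T, (-(ℓ i : ℂ)) = (-1) ^ T.card * ∏ i ∈ T, (ℓ i : ℂ) := by
    rw [← Finset.prod_const, ← Finset.prod_mul_distrib]
    exact Finset.prod_congr rfl fun i _ => by ring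
  rw [this]
  ring

end EulerFactorComparison

end Summit.BirchSwinnertonDyer.Rank1Residual.GaloisImage

end
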